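import Summits.CriticalPhenomena.PercolationContinuityZ3.Theorems.SoloBlindChainDepth
import Literature.Probability.Percolation.BKFinitary
import HarnessLib

/-!
# Alternating chains across an interface, II: disjoint witnesses and the BK bound

Continuation of `SoloBlindChainDepth` (seat `solo-CriticalPhenomena-blind`).  An exact chain of
`n` open interface edges from `x` realises the iterated disjoint occurrence
`{x ↔ u₀ via K₀} □ {u₀v₀ open} □ {v₀ ↔ u₁ via K₀} □ {u₁v₁ open} □ ⋯` of its *chain events*
(`chainEvents`, `mem_disjointOccurrenceList_of_exactChain`): the open witnesses live at pairwise
different depths and are therefore disjoint.  The tree's finitary BK inequality `bk_finitary_list`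
then bounds the probability by the product of the factors
(`real_disjointOccurrenceList_chainEvents_le`, `measure_disjointOccurrenceList_chainEvents_le`).
Sources: van den Berg–Kesten (1985); Grimmett, *Percolation* (2nd ed. 1999), Thm 2.12 and (2.17).
-/

noncomputable section

namespace Summit.CriticalPhenomena.PercolationContinuityZ3.Theorems

open MeasureTheory Literature.Probability.Percolation Literature.Probability.LatticeModels

section Events

variable {V : Type*}

/-- The alternating list of events of a chain: `{a ↔ u₀ via K₀}, {u₀v₀ open}, {v₀ ↔ u₁ via K₀},
{u₁v₁ open}, …` (independent of the configuration). -/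
def chainEvents (K₀ : SimpleGraph V) : V → List (V × V) → List (Set (BondConfig V))
  | _, [] => []
  | a, e :: l => openConnVia K₀ a e.1 :: {ω | s(e.1, e.2) ∈ ω} :: chainEvents K₀ e.2 l

/-- No events for the empty chain. -/
@[simp] theorem chainEvents_nil (K₀ : SimpleGraph V) (a : V) : chainEvents K₀ a [] = [] := rfl

/-- The chain events of `e :: l`: connection to `e.1`, the edge `e`, then the rest from `e.2`. -/
@[simp] theorem chainEvents_cons (K₀ : SimpleGraph V) (a : V) (e : V × V) (l : List (V × V)) :
    chainEvents K₀ a (e :: l) = openConnVia K₀ a e.1 :: {ω | s(e.1, e.2) ∈ ω} :: chainEvents K₀ e.2 l :=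
  rfl

/-- `{x ↔ y via K}` is finitary: an open path has finitely many edges. -/
theorem isFinitary_openConnVia [DecidableEq V] (K : SimpleGraph V) (x y : V) :
    IsFinitary (openConnVia K x y) := by
  intro ω hω
  have hω' : ω ∩ K.edgeSet ∈ openConn x y := hω
  obtain ⟨F, hF, hFmem⟩ := isFinitary_openConn x y _ hω'
  refine ⟨F, hF.trans Set.inter_subset_left, ?_⟩
  show (↑F : Set (Sym2 V)) ∩ K.edgeSet ∈ openConn x y
  rwa [Set.inter_eq_self_of_subset_left (hF.trans Set.inter_subset_right)]

/-- The single-edge event `{e open}` is finitary. -/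
theorem isFinitary_setOf_mem (e : Sym2 V) : IsFinitary {ω : BondConfig V | e ∈ ω} := by
  intro ω hω
  exact ⟨{e}, by simpa using hω, by simp⟩

/-- The single-edge event `{e open}` is increasing. -/
theorem isUpperSet_setOf_mem (e : Sym2 V) : IsUpperSet {ω : BondConfig V | e ∈ ω} :=
  fun _ _ h he => h he

/-- Chain events are increasing. -/
theorem chainEvents_isUpperSet (K₀ : SimpleGraph V) : ∀ (a : V) (l : List (V × V)),
    ∀ A ∈ chainEvents K₀ a l, IsUpperSet A
  | _, [] => by simp
  | a, e :: l => by
    intro A hA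
    simp only [chainEvents_cons, List.mem_cons] at hA
    rcases hA with rfl | rfl | hA
    · exact isUpperSet_openConnVia K₀ a e.1
    · exact isUpperSet_setOf_mem _
    · exact chainEvents_isUpperSet K₀ e.2 l A hA

/-- Chain events are finitary. -/
theorem chainEvents_isFinitary [DecidableEq V] (K₀ : SimpleGraph V) : ∀ (a : V) (l : List (V × V)),
    ∀ A ∈ chainEvents K₀ a l, IsFinitary A
  | _, [] => by simp
  | a, e :: l => by
    intro A hA
    simp only [chainEvents_cons, List.mem_cons] at hA
    rcases hA with rfl | rfl | hA
    · exact isFinitary_openConnVia K₀ a e.1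
    · exact isFinitary_setOf_mem _
    · exact chainEvents_isFinitary K₀ e.2 l A hA

variable {K₀ K : SimpleGraph V} {ω : BondConfig V} {x : V}

/-- An open `K₀`-walk inside a piece yields an open witness of `{a ↔ u via K₀}` all of whose
edges have both endpoints in the piece of `a`. -/
theorem exists_witness_openConnVia [DecidableEq V] {a u : V} (hu : u ∈ openClusterIn K₀ ω a) :
    ∃ W : Set (Sym2 V), W ⊆ ω ∧ W ∈ openConnVia K₀ a u ∧
      ∀ e ∈ W, ∀ p q : V, e = s(p, q) → p ∈ openClusterIn K₀ ω a ∧ q ∈ openClusterIn K₀ ω a := by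
  rw [mem_openClusterIn_iff] at hu
  obtain ⟨w⟩ := hu
  have hadj : ∀ p q : V, s(p, q) ∈ w.edges → (s(p, q) ∈ ω ∧ p ≠ q) ∧ K₀.Adj p q := by
    intro p q h
    have := w.adj_of_mem_edges h
    rwa [SimpleGraph.inf_adj, openGraph_adj] at this
  have hsupp : ∀ z ∈ w.support, z ∈ openClusterIn K₀ ω a := fun z hz =>
    mem_openClusterIn_iff.2 ⟨w.takeUntil z hz⟩
  refine ⟨{e | e ∈ w.edges}, ?_, ?_, ?_⟩
  · intro e he
    induction e using Sym2.ind with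
    | h p q => exact (hadj p q he).1.1
  · -- the same walk is an open `K₀`-walk of the witness configuration
    show u ∈ openClusterIn K₀ {e | e ∈ w.edges} a
    rw [mem_openClusterIn_iff]
    refine ⟨w.transfer (openGraph {e | e ∈ w.edges} ⊓ K₀) ?_⟩
    intro e he
    induction e using Sym2.ind with
    | h p q =>
      rw [SimpleGraph.mem_edgeSet, SimpleGraph.inf_adj, openGraph_adj]
      exact ⟨⟨he, (hadj p q he).1.2⟩, (hadj p q he).2⟩
  · intro e he p q hpq
    subst hpq
    exact ⟨hsupp p (w.fst_mem_support_of_mem_edges he), hsupp q (w.snd_mem_support_of_mem_edges he)⟩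

/-- The *deep* vertices: those of some exact depth `≥ k`. -/
def deepSet (K₀ K : SimpleGraph V) (ω : BondConfig V) (x : V) (k : ℕ) : Set V :=
  {u | ∃ j, k ≤ j ∧ u ∈ depthLayer K₀ K ω x j}

/-- Deep sets decrease in the depth. -/
theorem deepSet_anti {k k' : ℕ} {u : V} (h : u ∈ deepSet K₀ K ω x k) (hk : k' ≤ k) :
    u ∈ deepSet K₀ K ω x k' := by
  obtain ⟨j, hj, h⟩ := h
  exact ⟨j, hk.trans hj, h⟩

/-- A vertex of exact depth `k` is not deep of order `k + 1`. -/
theorem not_mem_deepSet_succ {k : ℕ} {u : V} (h : u ∈ depthLayer K₀ K ω x k) :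
    u ∉ deepSet K₀ K ω x (k + 1) := by
  rintro ⟨j, hj, h'⟩
  have := depthLayer_unique h h'
  omega

/-- **Witnesses of an exact chain.** Along an exact chain from a vertex `a` of exact depth `k`,
the chain events admit open witnesses which are pairwise disjoint (their edges live at different
depths). -/
theorem exists_witnessList_of_exactChain [DecidableEq V] {l : List (V × V)} :
    ∀ {k : ℕ} {a y : V}, a ∈ depthLayer K₀ K ω x k → ω ∈ exactChain K₀ K x k a l y →
    ∃ wl : List (Set (BondConfig V) × Set (Sym2 V)),
      wl.map Prod.fst = chainEvents K₀ a l ∧ (∀ p ∈ wl, p.2 ∈ p.1) ∧ (∀ p ∈ wl, p.2 ⊆ ω) ∧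
      wl.Pairwise (fun p q => Disjoint p.2 q.2) ∧
      ∀ p ∈ wl, ∀ e ∈ p.2, ∀ u v : V, e = s(u, v) → u ∈ deepSet K₀ K ω x k ∧ v ∈ deepSet K₀ K ω x k := by
  induction l with
  | nil =>
    intro k a y _ _
    exact ⟨[], by simp, by simp, by simp, List.Pairwise.nil, by simp⟩
  | cons e₀ l ih =>
    intro k a y ha hc
    obtain ⟨hu, ⟨hK, hω⟩, hv, htail⟩ := mem_exactChain_cons.1 hc
    obtain ⟨W, hWω, hWmem, hWpiece⟩ := exists_witness_openConnVia hu
    obtain ⟨wl, hmap, hmem, hsub, hdisj, hdeep⟩ := ih hv htail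
    have hdepth_u : e₀.1 ∈ depthLayer K₀ K ω x k := mem_depthLayer_of_mem_piece ha hu
    -- depth bookkeeping for the edges of `W`
    have hWdepth : ∀ e ∈ W, ∀ p q : V, e = s(p, q) → p ∈ depthLayer K₀ K ω x k ∧ q ∈ depthLayer K₀ K ω x k :=
      fun e he p q hpq => ⟨mem_depthLayer_of_mem_piece ha (hWpiece e he p q hpq).1,
        mem_depthLayer_of_mem_piece ha (hWpiece e he p q hpq).2⟩
    refine ⟨(openConnVia K₀ a e₀.1, W) :: ({ω | s(e₀.1, e₀.2) ∈ ω}, {s(e₀.1, e₀.2)}) :: wl,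
      by simp [hmap], ?_, ?_, ?_, ?_⟩
    · intro p hp
      simp only [List.mem_cons] at hp
      rcases hp with rfl | rfl | hp
      · exact hWmem
      · show s(e₀.1, e₀.2) ∈ ({s(e₀.1, e₀.2)} : Set (Sym2 V)); exact Set.mem_singleton _
      · exact hmem p hp
    · intro p hp
      simp only [List.mem_cons] at hp
      rcases hp with rfl | rfl | hp
      · exact hWω
      · exact Set.singleton_subset_iff.2 hω
      · exact hsub p hp
    · refine List.pairwise_cons.2 ⟨?_, List.pairwise_cons.2 ⟨?_, hdisj⟩⟩
      · intro q hq
        simp only [List.mem_cons] at hq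
        rcases hq with rfl | hq
        · -- `W` misses the interface edge: its far endpoint is one level deeper
          refine Set.disjoint_singleton_right.2 fun hin => ?_
          have := depthLayer_unique (hWdepth _ hin e₀.1 e₀.2 rfl).2 hv
          omega
        · refine Set.disjoint_left.2 fun e heW heq => ?_
          induction e using Sym2.ind with
          | h p q' =>
            exact not_mem_deepSet_succ (hWdepth _ heW p q' rfl).1 (hdeep q hq _ heq p q' rfl).1
      · intro q hq
        refine Set.disjoint_singleton_left.2 fun hin => ?_
        exact not_mem_deepSet_succ hdepth_u (hdeep q hq _ hin e₀.1 e₀.2 rfl).1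
    · intro p hp
      simp only [List.mem_cons] at hp
      rcases hp with rfl | rfl | hp
      · intro e he p q hpq
        exact ⟨⟨k, le_rfl, (hWdepth e he p q hpq).1⟩, ⟨k, le_rfl, (hWdepth e he p q hpq).2⟩⟩
      · intro e he p q hpq
        have he' : s(e₀.1, e₀.2) = s(p, q) := by
          rw [Set.mem_singleton_iff] at he; rw [← he]; exact hpq
        have hdu : e₀.1 ∈ deepSet K₀ K ω x k := ⟨k, le_rfl, hdepth_u⟩
        have hdv : e₀.2 ∈ deepSet K₀ K ω x k := ⟨k + 1, Nat.le_succ k, hv⟩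
        rcases Sym2.eq_iff.1 he' with ⟨h1, h2⟩ | ⟨h1, h2⟩
        · exact ⟨h1 ▸ hdu, h2 ▸ hdv⟩
        · exact ⟨h2 ▸ hdv, h1 ▸ hdu⟩
      · intro e he u v huv
        exact ⟨deepSet_anti (hdeep p hp e he u v huv).1 (Nat.le_succ k),
          deepSet_anti (hdeep p hp e he u v huv).2 (Nat.le_succ k)⟩

/-- **An exact chain realises the iterated disjoint occurrence of its chain events.** -/
theorem mem_disjointOccurrenceList_of_exactChain [DecidableEq V] {l : List (V × V)} {k : ℕ}
    {a y : V} (ha : a ∈ depthLayer K₀ K ω x k) (hc : ω ∈ exactChain K₀ K x k a l y) :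
    ω ∈ disjointOccurrenceList (chainEvents K₀ a l) := by
  obtain ⟨wl, hmap, hmem, hsub, hdisj, -⟩ := exists_witnessList_of_exactChain ha hc
  rw [← hmap]
  refine mem_disjointOccurrenceList_of_pairwise_disjoint wl (fun p hp => ?_) hmem hdisj hsub
  exact chainEvents_isUpperSet K₀ a l p.1 (hmap ▸ List.mem_map_of_mem (f := Prod.fst) hp)

/-- **Chains of every length in an infinite cluster** (event form): if every piece of `ω` is
finite, `K` is locally finite and the `K`-cluster of `x` is infinite, then for every `n` the
configuration lies in the disjoint occurrence of the chain events of some exact chain of length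
`n` from `x`. -/
theorem exists_exactChain_mem_disjointOccurrenceList [DecidableEq V]
    (hfin : ∀ v, (openClusterIn K₀ ω v).Finite) (hloc : ∀ u, (K.neighborSet u).Finite)
    (hinf : ω ∈ percolatesVia K x) (n : ℕ) :
    ∃ (l : List (V × V)) (y : V), l.length = n ∧ ω ∈ exactChain K₀ K x 0 x l y ∧
      ω ∈ disjointOccurrenceList (chainEvents K₀ x l) := by
  obtain ⟨l, y, hl, hc⟩ := exists_exactChain_of_infinite hfin hloc hinf n
  exact ⟨l, y, hl, hc, mem_disjointOccurrenceList_of_exactChain mem_depthLayer_zero hc⟩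

/-- **BK bound for chain events**: the probability of the iterated disjoint occurrence of the
chain events is at most the product of their probabilities (van den Berg–Kesten via the tree's
`bk_finitary_list`; Grimmett 1999, Thm 2.12 / (2.17)). -/
theorem real_disjointOccurrenceList_chainEvents_le [Countable V] [DecidableEq V]
    (G : SimpleGraph V) (p : unitInterval) (K₀ : SimpleGraph V) (a : V) (l : List (V × V)) :
    (bondPercolation G p).real (disjointOccurrenceList (chainEvents K₀ a l)) ≤
      ((chainEvents K₀ a l).map (bondPercolation G p).real).prod :=
  bk_finitary_list G p _ (chainEvents_isUpperSet K₀ a l) (chainEvents_isFinitary K₀ a l)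

/-- `ofReal` of a product of real probabilities is the product of the probabilities. -/
theorem ofReal_prod_map_real {Ω : Type*} [MeasurableSpace Ω] (μ : Measure Ω) [IsFiniteMeasure μ] :
    ∀ L : List (Set Ω), ENNReal.ofReal ((L.map μ.real).prod) = (L.map μ).prod
  | [] => by simp
  | A :: L => by
    rw [List.map_cons, List.prod_cons, List.map_cons, List.prod_cons,
      ENNReal.ofReal_mul measureReal_nonneg, ofReal_measureReal, ofReal_prod_map_real μ L]

/-- **BK bound for chain events, `ℝ≥0∞` form.** -/
theorem measure_disjointOccurrenceList_chainEvents_le [Countable V] [DecidableEq V]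
    (G : SimpleGraph V) (p : unitInterval) (K₀ : SimpleGraph V) (a : V) (l : List (V × V)) :
    bondPercolation G p (disjointOccurrenceList (chainEvents K₀ a l)) ≤
      ((chainEvents K₀ a l).map (bondPercolation G p)).prod := by
  rw [← ofReal_measureReal (measure_ne_top _ _), ← ofReal_prod_map_real]
  exact ENNReal.ofReal_le_ofReal (real_disjointOccurrenceList_chainEvents_le G p K₀ a l)

end Events

end Summit.CriticalPhenomena.PercolationContinuityZ3.Theorems

end
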